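import Literature.MathematicalPhysics.QuantumFieldTheory.Balaban1983to89.B8Ineq159FlatShellModeVacuity
import Literature.MathematicalPhysics.QuantumFieldTheory.Balaban1983to89.B9SupplySockB9P3ZdSocketBoundaryMode
import Literature.MathematicalPhysics.QuantumFieldTheory.Balaban1983to89.B8IdxB8LawsB

/-!
# `Balaban1983to89.B8SockB9P3ShellModeVacuityUniv` — KERNEL CERTIFICATE (the `Ω₀ = ℤᵈ` twin of `B8Ineq159FlatShellModeVacuity`, dag-n05-d's
# REQUEST): the socket of Proposition 3's frame `B8LeafModelZd3.SockB9P3 … η 1 Ω Λs Λb` ([Balaban1985RegularSpaces] (1.57)–(1.59) p. 86, five lines,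
# `|B₁|` over the bond class `Λb 1` = law №12 `towerBonds`) is FALSE at truncation `1` of a LAWFUL member of the sub-index of record `Node00.IdxB8SubB θ`
# — print's family `(T, □₁)` of (1.131), `Ω₀ = ℤᵈ`, `Λ′₀ = ℤᵈ ∖ □₁` — for every `B₀, B₀β, β, len` and `cP > 0`; hence the family hypothesis
# «`∀ i : IdxB8SubB θ, ∀ m ≤ k, SockB9P3 … m …`» of the `Ω₀ = ℤᵈ` knits is UNSATISFIABLE (`D ≥ 2`)

statement-level skeleton of published theorems with citation tags; proofs where landed; nothing here is a claim about the
Yang–Mills mass gap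

`[Balaban1985RegularSpaces]` ("B8", CMP **99** (1985) 75–102) (1.57)–(1.59) p. 86, (1.31) p. 82, (1.36)–(1.38) p. 82, (1.40) p. 83, (1.131) p. 99 («Λ′₀ = T ∖ □₁»),
(1.5)–(1.6) p. 77, (1.68) p. 88, p. 86 («𝔅_k»); [B6] = `[Balaban1984PropagatorsII]` (2.3) p. 224; [B7] = `[Balaban1985Averaging]` (8) p. 18, (122)∕(125) p. 36, (127)
p. 37; [4] = `[Balaban1985BackgroundPropagators]` Thm 3.3 p. 398, p. 394 («⊗ identity»), (3.28) p. 395.  PDF held: `paper:balaban1985-cmp99-regular-spaces-gauge-fixing`.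

CITATION HEADER (lean-in-tree rule).  Cell `pub-ymgap` (YM Track A, HUMAN RULING D-0062), DAG node N05 = [B8], seat `pub-ymgap-dag-n05-c` (g11; R134 s1),
INTENT-3 (dag-n05-d g9 REQUEST bus l.23508, dag-lead g12 DEDUP-344 (0) «n05-c's call»).  WHY: `B8Ineq159FlatShellModeVacuity` (p572834) certified the
interior shell gauge mode at the cube road's Dirichlet member (`Ω₀ = □₀`, `cubeLamB`); `B8Ineq159FlatCubeMemberPrinted.towerBonds_inner_of_printTower`
(p573921) showed that the MAXIMAL class the `ZdIdx` bond laws admit, `B8IdxB8LawsB.towerBonds`, has no crossing bond over ANY print-like tower.  THIS FILE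
runs the mode through the `Ω₀ = ℤᵈ` road's socket `SockB9P3` (U₀, W, 𝔸-valued exponent, five lines) at a LAWFUL member of `IdxB8SubB θ`, as n06-b's
`B9SupplySockB9P3ZdSocketBoundaryMode.not_sockB9P3D4_of_boundary` ran the `∂□₀` mode through `SockB9P3D4` (its pure-gauge apparatus is reused BY NAME:
`cfgExp_mem_unitaryUnits`, `expUnit_skew_mem_unitaryUnits`, `logCfg_cfgExp_of_small`, `Jcur_one_grad`, `B8Prop6OfThm4.one_inAk`, `B8Ineq132.inAk_gaugeAct_iff`;
the «⊗ identity» transfers are dag-n05-e's `B8Ineq159FlatMaps.isLandau138_map_flat` ∕ `map_linCovIter_flat`).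

THE MATHEMATICS (kernel-checked; `d ≥ 2`, `L ≥ 1`, `ρ ≥ 1`, `k ≥ 1`, `η > 0`; any C⋆-algebra `𝔸` with `1 ≠ 0`).
* §1 `covDerivFwd_flat_postcomp`, `covLap_indicator_covDivB_grad_flat_postcomp`, `shellMode_postcomp`: the shell-mode conditions (support, equal block
  sums, Landau block-constancy) are preserved by post-composition with any `ℝ`-linear `g : ℂ → ℂ` (real stencils); ★ `exists_real_shellMode`: a REAL-valued
  mode of any prescribed size `|λ| ≤ |t|·Λ₀` (`t·Re` or `t·Im` of p572834's mode).
* §2 `indicator_covDivB_grad_eq` (the `𝟙_{□₀}` cut-off is invisible: `D^{η*}_1∂λ` lives in `□₀`), ★ `isLandau138_univ_of_shellMode` ((1.38) on `Ω₀ = ℤᵈ`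
  with `Λ′₀ = ℤᵈ ∖ □₁`, `Λ₁ = □₁^{(1)}`: level-0 multiplier free off `□₁`, level-1 multiplier = the block constants), ★ `linCovIter_one_grad_level_one`
  (`L·Q₁(1)(iη∂λ)(c) = L^{−d}·i·(Σ_{B(c₊)}λ − Σ_{B(c₋)}λ)`), `towerBonds_one_ends` ∕ `towerBonds_zero_ends` (level-1 bonds of `towerBonds` have both ends in
  `□₁^{(1)}`, level-0 bonds both ends off `□₁`), `cfgExp_grad_eq_gaugeAct_of_commute` (n06-b's pure-gauge identity for commuting values).
* §3 ★★★ `not_sockB9P3_of_topCube`: at every `i : ZdIdx d L` with `Ω 0 = ℤᵈ`, `Ω 1 = □₁`, `Λs 1 0 = ℤᵈ ∖ □₁`, `Λs 1 1 = □₁^{(1)}`, `Λb 1 = towerBonds`: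
  `¬ SockB9P3 L B₀ B₀β cP β len i.η 1 i.Ω i.Λs i.Λb` for every `B₀, B₀β, β, len`, `cP > 0` — instance `α₀ = α₂ = cP`, `U₀ = 1`, `A′ = (D^η_1 λ)·1_𝔸` (`λ` real,
  size `t` with `‖A′‖ ≤ min{cP(Lη)⁻¹, (2η)⁻¹}`), `W = e^{iηA′}` (unitary, `= (1)^u` with `u = e^{−iλ}` ⇒ `W·1 ∈ 𝔄_1`; `(iη)⁻¹ log W = A′`; Landau of record =
  §2 ⊗ 1); line 1 gives `η‖A′(b₀)‖ ≤ |A′|₍₋₁₎ ≤ B₀(|J(A′)|₍₋₃₎ + |B₁(A′)|) = B₀·(0 + 0)` (`J = 0`; every `Λb 1 j` datum `0`) — contradiction at a bond where `λ` jumps.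
* §4 ★★ `exists_topCube_member_lawsB`: print's `(T, □₁, …, □_k)` (`cubeFam true`, `Λ′₀ = ℤᵈ ∖ □₁` at every truncation `m ≥ 1`, `ℤᵈ` at `m = 0`, `cubeLamS`
  above, `Λb := towerBonds`) as a `ZdIdx` member obeying `hbox`∕`hclass`∕`htower`∕`hpart` AND the located laws `IdxB8Laws` (№7 under `Lᵏη ≤ 1`, №8 via
  `B8SockHFPCubeMember.h8lt∕h8top_cubeLamS`, №11 via `B8CubeMemberIdxB8Laws.cover_cubeLamS`) AND №12 (`rfl`); ★★★ `exists_idxB8SubB_not_sockB9P3`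
  (`k = 1`, `η = L⁻¹`: a term of `IdxB8SubB θ` at which the socket fails for all `B₀ B₀β β len`, `cP > 0`); ★★★ `not_sB9all_idxB8SubB`: the family hypothesis
  «`∀ i : IdxB8SubB θ, ∀ m ≤ i.k, SockB9P3 … m …`» is FALSE (`2 ≤ θ.D`).

CONSEQUENCE (count-neutral; for the owners ∕ referees, nothing of theirs restated): every knit of the `Ω₀ = ℤᵈ` road that takes the `SockB9P3` family over
`IdxB8SubB θ` (or derives it from `B9.Thm33Printed` + the law-member dictionary, n06-b `sockB9P3_allLevels_univ_explicit_on`) has an unsatisfiable hypothesis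
set at the binder level declared A6-unchecked («m ≥ 1»); the dictionary's joint unsatisfiability with Theorem 3.3 is dag-n05-d's one-screen corollary.  REPAIR =
the index laws (`ZdIdx.hbox` admitting print's crossing bonds, fine box in `Ω_{j−1}`), as located in p572834 ∕ p573921.

HONEST SCOPE.  A refutation of a TYPED hypothesis family by an explicit field; nothing of Bałaban asserted or denied (print's `|B₁|` includes the crossing
contours (1.31), which kill the mode); N05∕N06 NOT discharged; one finite `T⁴` programme at fixed `ε`, Bałaban as printed; nothing continuum ∕ ℝ⁴ ∕ OS ∕
mass-gap ∕ Clay.  No `sorry`, no `def`, no `instance`, no `notation`.  Unit `pub-ymgap-dag-n05-c` (g11), 2026-08-27.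
-/

noncomputable section

open NormedSpace

namespace Literature.MathematicalPhysics.QuantumFieldTheory.Balaban1983to89.B8SockB9P3ShellModeVacuityUniv

open Complex (I)
open B7Prop1Explicit B7Prop2Explicit B7Prop1Local MatrixLog
open B7Prop4GeneralLevels (linCovIter linCovIter_zero linCovIter_succ)
open B7Prop3GeneralLinear (linQcov_one_left)
open B7Prop3Flat (linQ)
open B8Ineq132 (covDerivFwd BondTouches InAk Under)
open B8Eq140Level (SideTouches sideTouches_of_bondTouches)
open B8Eq143PlaqExpansion (pdiv)
open B8Eq146AExpansion (iEta plaqCovDeriv)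
open B8Eq155JBound (Jcur wsup wsup_le wsup_nonneg)
open B8ScaledSupNorm (bondNorm msup weight msup_le msup_nonneg Bdd weight_mul_norm_le_msup bondNorm_zero)
open B8Eq138LandauZd (IsLandau138 IsLandau138W covLap covDivB QT logCfg)
open B8Eq184Proof (cfgExp)
open B8Lemma1NonAbelian (mulCfg)
open B8Eq131Cubes (cube sqLo sqHi inLo inHi mem_cube_iff cube_succ_subset)
open B8Eq131CubesAdmissible (cubeFam cubeFam_false_zero cubeFam_true_zero cubeFam_of_pos smul_mem_cube_iff smul_mem_cube_succ_iff
  add_mem_cube_of_mem_succ cubeFam_domainSeq)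
open B8CubeMemberZd (cubeLam cubeLamS mem_cubeLam_zero_iff cubeLamS_of_lt cubeLamS_self inBox_sq_of_mem_cubeLamS smul_mem_bondBox
  smul_add_mem_bondBox cubeLamS_top htower_cubeLam hpart_cubeLam inBox_tower_iff_under)
open B8IdxB8LawsB (towerBonds towerBonds_hbox towerBonds_hclass IdxB8LawsB IdxB8SubB)
open B8LeafModelZd (ZdIdx)
open B8LeafModelZd3 (SockB9P3)
open B8Eq191FlatStencils (covDerivFwd_flat_apply covDeriv_flat_apply covLap_flat_apply QT_flat_apply)
open B8Eq191FlatLettersCubeMember (inBox_finite under_iff_blockMap_eq under_smul_self)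
open B8Ineq159FlatShellModeVacuity (exists_shellMode blockMap_smul_self)
open B9SupplySockB9P3ZdSocketBoundaryMode (isSelfAdjoint_real_smul_one norm_real_smul_one cfgExp_mem_unitaryUnits
  expUnit_skew_mem_unitaryUnits logCfg_cfgExp_of_small exists_ne_fin)
open B9SupplySockB9P3ZdAtBoundaryMode (Jcur_one_grad)
open Node00 (IdxB8Laws IdxB8 IdxB8Sub Stage3Params)
open Literature.MathematicalPhysics.QuantumLattice (blockMap blockMap_one blockSites mem_blockSites_iff)

export B7Prop1Explicit (Site)

variable {d : ℕ}

/-! ## §1 Real-valued shell modes: the flat stencils commute with `ℝ`-linear maps of `ℂ` -/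

/-- The flat forward derivative commutes with post-composition by an `ℝ`-linear `g : ℂ → ℂ`. [cite: Balaban1985RegularSpaces, (1.1) p.76] -/
theorem covDerivFwd_flat_postcomp (g : ℂ →ₗ[ℝ] ℂ) (η : ℝ) (κ : Fin d) (f : Site d → ℂ) (y : Site d) :
    covDerivFwd η (1 : Site d → Fin d → ℂˣ) κ (fun w => g (f w)) y = g (covDerivFwd η (1 : Site d → Fin d → ℂˣ) κ f y) := by
  rw [covDerivFwd_flat_apply, covDerivFwd_flat_apply, g.map_smul, map_sub]

/-- The flat quantity `Δ^η_1(𝟙_{Ω₀}·D^{η*}_1 ∂f)` commutes with post-composition by an `ℝ`-linear `g : ℂ → ℂ`.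
[cite: Balaban1985RegularSpaces, (1.38) p.82; Balaban1985BackgroundPropagators, (3.23)–(3.24) p.394] -/
theorem covLap_indicator_covDivB_grad_flat_postcomp (g : ℂ →ₗ[ℝ] ℂ) (η : ℝ) (Ω₀ : Set (Site d)) (f : Site d → ℂ) (x : Site d) :
    covLap η (1 : Site d → Fin d → ℂˣ) (Ω₀.indicator (covDivB η (1 : Site d → Fin d → ℂˣ)
        (fun y κ => covDerivFwd η (1 : Site d → Fin d → ℂˣ) κ (fun w => g (f w)) y))) x =
      g (covLap η (1 : Site d → Fin d → ℂˣ) (Ω₀.indicator (covDivB η (1 : Site d → Fin d → ℂˣ)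
        (fun y κ => covDerivFwd η (1 : Site d → Fin d → ℂˣ) κ f y))) x) := by
  classical
  have hD : ∀ z, covDivB η (1 : Site d → Fin d → ℂˣ) (fun y κ => covDerivFwd η (1 : Site d → Fin d → ℂˣ) κ (fun w => g (f w)) y) z =
      g (covDivB η (1 : Site d → Fin d → ℂˣ) (fun y κ => covDerivFwd η (1 : Site d → Fin d → ℂˣ) κ f y) z) := by
    intro z
    simp only [covDivB, covDeriv_flat_apply, covDerivFwd_flat_postcomp, map_sum, g.map_smul, map_sub]
  have hI : ∀ z, Ω₀.indicator (covDivB η (1 : Site d → Fin d → ℂˣ)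
        (fun y κ => covDerivFwd η (1 : Site d → Fin d → ℂˣ) κ (fun w => g (f w)) y)) z =
      g (Ω₀.indicator (covDivB η (1 : Site d → Fin d → ℂˣ) (fun y κ => covDerivFwd η (1 : Site d → Fin d → ℂˣ) κ f y)) z) := by
    intro z
    by_cases hz : z ∈ Ω₀
    · rw [Set.indicator_of_mem hz, Set.indicator_of_mem hz, hD]
    · rw [Set.indicator_of_notMem hz, Set.indicator_of_notMem hz, map_zero]
  rw [covLap_flat_apply, covLap_flat_apply, map_sum]
  refine Finset.sum_congr rfl fun μ _ => ?_
  rw [hI, hI, hI, g.map_smul, map_sub, map_sub, g.map_smul]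

/-- **Post-composition of a shell mode by an `ℝ`-linear `g : ℂ → ℂ` is a shell mode** (support, equal block sums, Landau block-constancy are
`ℝ`-linear conditions with real stencils): used with `g = t·Re`, `g = t·Im`. [cite: Balaban1985RegularSpaces, (1.38) p.82, (1.31) p.82, (1.131) p.99] -/
theorem shellMode_postcomp (g : ℂ →ₗ[ℝ] ℂ) {L : ℕ} {η : ℝ} {a : Site d} {M ρ k : ℕ} {lam : Site d → ℂ}
    (hsupp : ∀ x, x ∉ cube L a M ρ k 1 → lam x = 0)
    (hsum : ∀ z z', InBox (sqLo L a ρ k 1) (sqHi L a M ρ k 1) z → InBox (sqLo L a ρ k 1) (sqHi L a M ρ k 1) z' →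
        ∑ r : Fin d → Fin L, lam ((L : ℤ) • z + boxVec L r) = ∑ r : Fin d → Fin L, lam ((L : ℤ) • z' + boxVec L r))
    (hlan : ∀ x ∈ cube L a M ρ k 1, ∀ x' ∈ cube L a M ρ k 1, blockMap (L ^ 1) x = blockMap (L ^ 1) x' →
        covLap η (1 : Site d → Fin d → ℂˣ) ((cube L a M ρ k 0).indicator
            (covDivB η (1 : Site d → Fin d → ℂˣ) (fun y κ => covDerivFwd η (1 : Site d → Fin d → ℂˣ) κ lam y))) x =
        covLap η (1 : Site d → Fin d → ℂˣ) ((cube L a M ρ k 0).indicator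
            (covDivB η (1 : Site d → Fin d → ℂˣ) (fun y κ => covDerivFwd η (1 : Site d → Fin d → ℂˣ) κ lam y))) x') :
    (∀ x, x ∉ cube L a M ρ k 1 → g (lam x) = 0) ∧
    (∀ z z', InBox (sqLo L a ρ k 1) (sqHi L a M ρ k 1) z → InBox (sqLo L a ρ k 1) (sqHi L a M ρ k 1) z' →
        ∑ r : Fin d → Fin L, g (lam ((L : ℤ) • z + boxVec L r)) = ∑ r : Fin d → Fin L, g (lam ((L : ℤ) • z' + boxVec L r))) ∧
    (∀ x ∈ cube L a M ρ k 1, ∀ x' ∈ cube L a M ρ k 1, blockMap (L ^ 1) x = blockMap (L ^ 1) x' →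
        covLap η (1 : Site d → Fin d → ℂˣ) ((cube L a M ρ k 0).indicator
            (covDivB η (1 : Site d → Fin d → ℂˣ) (fun y κ => covDerivFwd η (1 : Site d → Fin d → ℂˣ) κ (fun w => g (lam w)) y))) x =
        covLap η (1 : Site d → Fin d → ℂˣ) ((cube L a M ρ k 0).indicator
            (covDivB η (1 : Site d → Fin d → ℂˣ) (fun y κ => covDerivFwd η (1 : Site d → Fin d → ℂˣ) κ (fun w => g (lam w)) y))) x') := by
  refine ⟨fun x hx => by rw [hsupp x hx, map_zero], fun z z' hz hz' => ?_, fun x hx x' hx' hxx' => ?_⟩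
  · rw [← map_sum, ← map_sum, hsum z z' hz hz']
  · rw [covLap_indicator_covDivB_grad_flat_postcomp, covLap_indicator_covDivB_grad_flat_postcomp, hlan x hx x' hx' hxx']

/-- ★ **A REAL-VALUED SHELL MODE OF ANY PRESCRIBED SIZE**: for every cube datum with `ρ ≥ 1` there is `Λ₀ ≥ 0` such that for every real `t ≠ 0`
there is `λ : ℤᵈ → ℂ` with REAL values, `λ ≠ 0`, `|λ| ≤ |t|·Λ₀`, supported in `□₁`, with equal `L`-block sums over `□₁^{(1)}` and with
`Δ^η_1(𝟙_{□₀}·D^{η*}_1∂λ)` constant on the `L`-blocks of `□₁` (the real or the imaginary part of `exists_shellMode`'s mode, rescaled).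
[cite: Balaban1985RegularSpaces, (1.38) p.82, (1.31) p.82, (1.131) p.99; Balaban1984PropagatorsII, (2.6)–(2.7) p.224] -/
theorem exists_real_shellMode {L : ℕ} (hL : 1 ≤ L) (η : ℝ) (a : Site d) (M : ℕ) {ρ : ℕ} (hρ : 1 ≤ ρ) (k : ℕ) :
    ∃ Λ₀ : ℝ, 0 ≤ Λ₀ ∧ ∀ t : ℝ, t ≠ 0 → ∃ lam : Site d → ℂ,
      (∀ x, ((lam x).re : ℂ) = lam x) ∧
      (∀ x, x ∉ cube L a M ρ k 1 → lam x = 0) ∧ (∃ x, lam x ≠ 0) ∧ (∀ x, ‖lam x‖ ≤ |t| * Λ₀) ∧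
      (∀ z z', InBox (sqLo L a ρ k 1) (sqHi L a M ρ k 1) z → InBox (sqLo L a ρ k 1) (sqHi L a M ρ k 1) z' →
        ∑ r : Fin d → Fin L, lam ((L : ℤ) • z + boxVec L r) = ∑ r : Fin d → Fin L, lam ((L : ℤ) • z' + boxVec L r)) ∧
      (∀ x ∈ cube L a M ρ k 1, ∀ x' ∈ cube L a M ρ k 1, blockMap (L ^ 1) x = blockMap (L ^ 1) x' →
        covLap η (1 : Site d → Fin d → ℂˣ) ((cube L a M ρ k 0).indicator
            (covDivB η (1 : Site d → Fin d → ℂˣ) (fun y κ => covDerivFwd η (1 : Site d → Fin d → ℂˣ) κ lam y))) x =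
        covLap η (1 : Site d → Fin d → ℂˣ) ((cube L a M ρ k 0).indicator
            (covDivB η (1 : Site d → Fin d → ℂˣ) (fun y κ => covDerivFwd η (1 : Site d → Fin d → ℂˣ) κ lam y))) x') := by
  obtain ⟨lam, hsupp, ⟨x₀, hx₀⟩, ⟨Λ, hΛ⟩, hsum, hlan⟩ := exists_shellMode hL η a M hρ k
  have hΛ0 : 0 ≤ Λ := (norm_nonneg _).trans (hΛ x₀)
  refine ⟨Λ, hΛ0, fun t ht => ?_⟩
  -- the real or the imaginary part is non-zero at `x₀`
  have hparts : (lam x₀).re ≠ 0 ∨ (lam x₀).im ≠ 0 := by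
    by_contra h
    push Not at h
    exact hx₀ (Complex.ext h.1 h.2)
  -- the `ℝ`-linear maps `z ↦ t·Re z`, `z ↦ t·Im z` (as complex numbers)
  let gre : ℂ →ₗ[ℝ] ℂ := t • (Complex.ofRealAm.toLinearMap ∘ₗ Complex.reLm)
  let gim : ℂ →ₗ[ℝ] ℂ := t • (Complex.ofRealAm.toLinearMap ∘ₗ Complex.imLm)
  have hgre : ∀ z, gre z = ((t * z.re : ℝ) : ℂ) := fun z => by
    simp [gre, Complex.ofReal_mul]
  have hgim : ∀ z, gim z = ((t * z.im : ℝ) : ℂ) := fun z => by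
    simp [gim, Complex.ofReal_mul]
  rcases hparts with hre | him
  · obtain ⟨h1, h2, h3⟩ := shellMode_postcomp gre hsupp hsum hlan
    refine ⟨fun w => gre (lam w), fun x => by dsimp only; rw [hgre, Complex.ofReal_re], h1, ⟨x₀, ?_⟩, fun x => ?_, h2, h3⟩
    · dsimp only; rw [hgre]; exact_mod_cast mul_ne_zero ht hre
    · dsimp only; rw [hgre, Complex.norm_real, Real.norm_eq_abs, abs_mul]
      exact mul_le_mul_of_nonneg_left ((Complex.abs_re_le_norm _).trans (hΛ x)) (abs_nonneg _)
  · obtain ⟨h1, h2, h3⟩ := shellMode_postcomp gim hsupp hsum hlan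
    refine ⟨fun w => gim (lam w), fun x => by dsimp only; rw [hgim, Complex.ofReal_re], h1, ⟨x₀, ?_⟩, fun x => ?_, h2, h3⟩
    · dsimp only; rw [hgim]; exact_mod_cast mul_ne_zero ht him
    · dsimp only; rw [hgim, Complex.norm_real, Real.norm_eq_abs, abs_mul]
      exact mul_le_mul_of_nonneg_left ((Complex.abs_im_le_norm _).trans (hΛ x)) (abs_nonneg _)


/-! ## §2 The shell mode at `U₀ = 1`: Landau condition of record with `Ω₀ = ℤᵈ`, and the level-`1` averaging datum -/

/-- The flat gradient `∂λ` of a function supported in `□₁` vanishes on every bond no end of which lies in `□₁`. [cite: Balaban1985RegularSpaces, (1.1) p.76, p.77 (bond convention)] -/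
theorem grad_eq_zero_of_notMem {L : ℕ} {η : ℝ} {a : Site d} {M ρ k : ℕ} {lam : Site d → ℂ}
    (hsupp : ∀ x, x ∉ cube L a M ρ k 1 → lam x = 0) {y : Site d} {τ : Fin d}
    (hy : y ∉ cube L a M ρ k 1) (hy' : y + e τ ∉ cube L a M ρ k 1) :
    covDerivFwd η (1 : Site d → Fin d → ℂˣ) τ lam y = 0 := by
  rw [covDerivFwd_flat_apply, hsupp _ hy, hsupp _ hy', sub_zero, smul_zero]

/-- The divergence `D^{η*}_1∂λ` of the gradient of a function supported in `□₁` is supported in `□₀` (collar `ρ ≥ 1`, `k ≥ 1`), so the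
`𝟙_{□₀}` cut-off of the Dirichlet reading is invisible: `𝟙_{□₀}·D^{η*}_1∂λ = D^{η*}_1∂λ`. [cite: Balaban1985RegularSpaces, (1.38) p.82, p.98 (collar)] -/
theorem indicator_covDivB_grad_eq {L : ℕ} (η : ℝ) {a : Site d} {M ρ k : ℕ} (hρ : 1 ≤ ρ) (hk : 1 ≤ k) {lam : Site d → ℂ}
    (hsupp : ∀ x, x ∉ cube L a M ρ k 1 → lam x = 0) :
    (cube L a M ρ k 0).indicator (covDivB η (1 : Site d → Fin d → ℂˣ) (fun y κ => covDerivFwd η (1 : Site d → Fin d → ℂˣ) κ lam y)) =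
      covDivB η (1 : Site d → Fin d → ℂˣ) (fun y κ => covDerivFwd η (1 : Site d → Fin d → ℂˣ) κ lam y) := by
  classical
  funext z
  by_cases hz : z ∈ cube L a M ρ k 0
  · rw [Set.indicator_of_mem hz]
  · rw [Set.indicator_of_notMem hz]
    symm
    have h10 : cube L a M ρ k 1 ⊆ cube L a M ρ k 0 := cube_succ_subset (by omega)
    have hcol : ∀ x ∈ cube L a M ρ k 1, ∀ μ : Fin d, x + e μ ∈ cube L a M ρ k 0 ∧ x - e μ ∈ cube L a M ρ k 0 := by
      intro x hx μ
      have hb : ∀ i, |(e μ : Site d) i| ≤ ((ρ * L ^ 0 : ℕ) : ℤ) := by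
        intro i
        rw [pow_zero, mul_one]
        change |(Pi.single μ (1 : ℤ) : Fin d → ℤ) i| ≤ (ρ : ℤ)
        rw [Pi.single_apply]
        split_ifs
        · simp only [abs_one]; exact_mod_cast hρ
        · simp
      have hb' : ∀ i, |(-(e μ) : Site d) i| ≤ ((ρ * L ^ 0 : ℕ) : ℤ) := fun i => by rw [Pi.neg_apply, abs_neg]; exact hb i
      exact ⟨add_mem_cube_of_mem_succ (j := 0) (by omega) hx hb,
        by rw [sub_eq_add_neg]; exact add_mem_cube_of_mem_succ (j := 0) (by omega) hx hb'⟩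
    -- every bond met by the stencil at `z` avoids `□₁`
    have hz1 : z ∉ cube L a M ρ k 1 := fun h => hz (h10 h)
    have hzp : ∀ μ : Fin d, z + e μ ∉ cube L a M ρ k 1 := fun μ h => hz (by
      have := (hcol _ h μ).2; rwa [add_sub_cancel_right] at this)
    have hzm : ∀ μ : Fin d, z - e μ ∉ cube L a M ρ k 1 := fun μ h => hz (by
      have := (hcol _ h μ).1; rwa [sub_add_cancel] at this)
    simp only [covDivB, covDeriv_flat_apply]
    refine Finset.sum_eq_zero fun μ _ => ?_
    rw [grad_eq_zero_of_notMem hsupp hz1 (hzp μ), grad_eq_zero_of_notMem hsupp (hzm μ) (by rw [sub_add_cancel]; exact hz1),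
      sub_zero, smul_zero]

/-- ★ **THE SHELL MODE IS IN THE LANDAU GAUGE OF RECORD ON `Ω₀ = ℤᵈ`** at truncation `1` with the level-0 restriction set `ℤᵈ ∖ □₁` (print's
`Λ′₀ = T ∖ □₁`) and `Λ₁ = □₁^{(1)}`: the level-0 multiplier is free off `□₁`, the level-1 multiplier carries the block constants.
[cite: Balaban1985RegularSpaces, (1.38) p.82, (1.131) p.99 («Λ′₀ = T ∖ □₁»); Balaban1985BackgroundPropagators, (3.23)–(3.25) p.394] -/
theorem isLandau138_univ_of_shellMode {L : ℕ} (hL : 1 ≤ L) (η : ℝ) {a : Site d} {M ρ k : ℕ} (hρ : 1 ≤ ρ) (hk : 1 ≤ k)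
    {lam : Site d → ℂ} (hsupp : ∀ x, x ∉ cube L a M ρ k 1 → lam x = 0)
    (hlan : ∀ x ∈ cube L a M ρ k 1, ∀ x' ∈ cube L a M ρ k 1, blockMap (L ^ 1) x = blockMap (L ^ 1) x' →
        covLap η (1 : Site d → Fin d → ℂˣ) ((cube L a M ρ k 0).indicator
            (covDivB η (1 : Site d → Fin d → ℂˣ) (fun y κ => covDerivFwd η (1 : Site d → Fin d → ℂˣ) κ lam y))) x =
        covLap η (1 : Site d → Fin d → ℂˣ) ((cube L a M ρ k 0).indicator
            (covDivB η (1 : Site d → Fin d → ℂˣ) (fun y κ => covDerivFwd η (1 : Site d → Fin d → ℂˣ) κ lam y))) x')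
    {Λs : ℕ → Set (Site d)} (hΛ0 : Λs 0 = (cube L a M ρ k 1)ᶜ) (hΛ1 : Λs 1 = {z | InBox (sqLo L a ρ k 1) (sqHi L a M ρ k 1) z}) :
    IsLandau138 L 1 η Set.univ Λs (1 : Site d → Fin d → ℂˣ) (fun y κ => covDerivFwd η (1 : Site d → Fin d → ℂˣ) κ lam y) := by
  classical
  set H : Site d → ℂ := fun x => covLap η (1 : Site d → Fin d → ℂˣ) ((cube L a M ρ k 0).indicator
    (covDivB η (1 : Site d → Fin d → ℂˣ) (fun y κ => covDerivFwd η (1 : Site d → Fin d → ℂˣ) κ lam y))) x with hH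
  refine ⟨fun j y => if j = 0 then H y else (((L : ℝ) ^ d) • H (((L : ℤ) ^ 1) • y)), ?_⟩
  intro x _
  rw [Set.indicator_univ, ← indicator_covDivB_grad_eq η hρ hk hsupp,
    QT_flat_apply, Finset.sum_range_succ, Finset.sum_range_succ, Finset.sum_range_zero, zero_add, pow_zero, pow_zero,
    blockMap_one, one_smul, pow_one (((L : ℝ) ^ d)⁻¹), hΛ0, hΛ1]
  by_cases hx1 : x ∈ cube L a M ρ k 1
  · have hx0 : x ∉ (cube L a M ρ k 1)ᶜ := fun h => h hx1
    obtain ⟨z, hz, hu⟩ := (mem_cube_iff hL).1 hx1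
    have hzx : blockMap (L ^ 1) x = z := (under_iff_blockMap_eq hL 1 z x).1 hu
    have hbm : blockMap (L ^ 1) x ∈ {z | InBox (sqLo L a ρ k 1) (sqHi L a M ρ k 1) z} := by rw [hzx]; exact hz
    rw [Set.indicator_of_notMem hx0, Set.indicator_of_mem hbm, zero_add, if_neg one_ne_zero, smul_smul,
      inv_mul_cancel₀ (by positivity), one_smul]
    have hbase : ((L : ℤ) ^ 1) • blockMap (L ^ 1) x ∈ cube L a M ρ k 1 := by
      rw [hzx]; exact (smul_mem_cube_iff hL a M ρ k 1 z).2 hz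
    have hblk : blockMap (L ^ 1) x = blockMap (L ^ 1) (((L : ℤ) ^ 1) • blockMap (L ^ 1) x) := by
      rw [hzx, blockMap_smul_self hL z]
    exact hlan x hx1 _ hbase hblk
  · have hx0 : x ∈ (cube L a M ρ k 1)ᶜ := hx1
    have hbm : blockMap (L ^ 1) x ∉ {z | InBox (sqLo L a ρ k 1) (sqHi L a M ρ k 1) z} := by
      intro h
      exact hx1 ((mem_cube_iff hL).2 ⟨_, h, (under_iff_blockMap_eq hL 1 _ x).2 rfl⟩)
    rw [Set.indicator_of_mem hx0, Set.indicator_of_notMem hbm, smul_zero, add_zero, if_pos rfl]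

/-- ★ **THE LEVEL-1 AVERAGING DATUM OF A FLAT GRADIENT**: `L·Q₁(1)(iη∂λ)(c) = L^{−d}·i·(Σ_{B(c₊)}λ − Σ_{B(c₋)}λ)` (flat composite (127) at
`U₀ = 1`, one step: `linQcov_one_left`, `asum_seg_natCast`, telescoping along the straight contours). [cite: Balaban1985Averaging, (122) + (125) p.36, (127) p.37; Balaban1985RegularSpaces, (1.31) p.82] -/
theorem linCovIter_one_grad_level_one {L : ℕ} (hL : 1 ≤ L) {η : ℝ} (hη : 0 < η) {lam : Site d → ℂ} {Λ : ℝ}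
    (hΛ : ∀ x, ‖lam x‖ ≤ Λ) (z : Site d) (κ : Fin d) :
    linCovIter L (1 : Site d → Fin d → ℂˣ) (iEta η (fun y τ => covDerivFwd η (1 : Site d → Fin d → ℂˣ) τ lam y)) 1 z κ =
      (((L : ℝ) ^ d)⁻¹ : ℝ) • (Complex.I * (∑ r : Fin d → Fin L, lam ((L : ℤ) • (z + e κ) + boxVec L r) -
        ∑ r : Fin d → Fin L, lam ((L : ℤ) • z + boxVec L r))) := by
  have hΛ0 : 0 ≤ Λ := (norm_nonneg _).trans (hΛ z)
  have hηC : (η : ℂ) ≠ 0 := Complex.ofReal_ne_zero.2 hη.ne'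
  set φ : Site d → Fin d → ℂ := fun y τ => covDerivFwd η (1 : Site d → Fin d → ℂˣ) τ lam y with hφdef
  have hφ : ∀ y τ, φ y τ = η⁻¹ • (lam (y + e τ) - lam y) := fun y τ => covDerivFwd_flat_apply η τ lam y
  have hφbd : ∀ y τ, ‖φ y τ‖ ≤ η⁻¹ * (Λ + Λ) := fun y τ => B8Ineq159FlatMaps.norm_covDerivFwd_flat_le hη hΛ τ y
  have hMb : ∀ x τ, ‖iEta η φ x τ‖ ≤ η * (η⁻¹ * (Λ + Λ)) := B8Eq146AExpansion.norm_iEta_le hη.le hφbd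
  have hiEta : ∀ (w : Site d) (τ : Fin d), iEta η φ w τ = Complex.I * (lam (w + e τ) - lam w) := by
    intro w τ
    simp only [B8Eq146AExpansion.iEta_def, hφ, Complex.real_smul, smul_eq_mul]
    push_cast
    rw [mul_assoc, ← mul_assoc (η : ℂ), mul_inv_cancel₀ hηC, one_mul]
  have htel : ∀ (p : Site d) (τ : Fin d),
      ∑ i ∈ Finset.range L, iEta η φ (p + (i : ℤ) • e τ) τ = Complex.I * (lam (p + (L : ℤ) • e τ) - lam p) := by
    intro p τ
    have hshift : ∀ i : ℕ, p + (i : ℤ) • e τ + e τ = p + ((i + 1 : ℕ) : ℤ) • e τ := by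
      intro i; push_cast; rw [add_smul, one_smul, add_assoc]
    simp_rw [hiEta, hshift]
    have hsub := Finset.sum_range_sub (fun i : ℕ => lam (p + (i : ℤ) • e τ)) L
    rw [← Finset.mul_sum, hsub]
    simp
  show linCovIter L (1 : Site d → Fin d → ℂˣ) (iEta η φ) (0 + 1) z κ = _
  rw [linCovIter_succ, linCovIter_zero, avgIter_zero,
    linQcov_one_left L hL (iEta η φ) (mul_nonneg hη.le (mul_nonneg (inv_nonneg.2 hη.le) (add_nonneg hΛ0 hΛ0))) hMb]
  simp only [linQ, asum_seg_natCast, htel]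
  have hpt : ∀ r : Fin d → Fin L, (L : ℤ) • z + boxVec L r + (L : ℤ) • e κ = (L : ℤ) • (z + e κ) + boxVec L r := by
    intro r; rw [smul_add]; abel
  simp_rw [hpt]
  simp only [mul_sub, smul_sub, Finset.sum_sub_distrib, Finset.mul_sum, Finset.smul_sum]

/-- Over a tower with `Ω 1 = □₁`, every level-`1` bond of `towerBonds` has both ends in `□₁^{(1)}` (the class's box condition).
[cite: Balaban1985RegularSpaces, (1.31) p.82, (1.131) p.99] -/
theorem towerBonds_one_ends {L : ℕ} (hL : 1 ≤ L) {Ω Λ : ℕ → Set (Site d)} {a : Site d} {M ρ k : ℕ}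
    (hΩ1 : Ω 1 = cube L a M ρ k 1) {c : Site d × Fin d} (hc : c ∈ towerBonds L Ω Λ 1) :
    InBox (sqLo L a ρ k 1) (sqHi L a M ρ k 1) c.1 ∧ InBox (sqLo L a ρ k 1) (sqHi L a M ρ k 1) (c.1 + e c.2) := by
  have hbox := hc.1
  rw [hΩ1] at hbox
  exact ⟨(smul_mem_cube_iff hL a M ρ k 1 c.1).1 (hbox _ (smul_mem_bondBox hL 1 c.1 c.2)),
    (smul_mem_cube_iff hL a M ρ k 1 (c.1 + e c.2)).1 (hbox _ (smul_add_mem_bondBox hL 1 c.1 c.2))⟩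

/-- Over a tower with `Λ 0 = (□₁)ᶜ`, a level-`0` bond of `towerBonds` has both ends outside `□₁` (the crossing disjuncts need `0 = j′ + 1`).
[cite: Balaban1985RegularSpaces, (1.31) p.82, (1.131) p.99 («Λ′₀ = T ∖ □₁»)] -/
theorem towerBonds_zero_ends {L : ℕ} {Ω Λ : ℕ → Set (Site d)} {a : Site d} {M ρ k : ℕ}
    (hΛ0 : Λ 0 = (cube L a M ρ k 1)ᶜ) {c : Site d × Fin d} (hc : c ∈ towerBonds L Ω Λ 0) :
    c.1 ∉ cube L a M ρ k 1 ∧ c.1 + e c.2 ∉ cube L a M ρ k 1 := by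
  rcases hc.2 with ⟨h1, h2⟩ | ⟨j', hj', -⟩ | ⟨j', hj', -⟩
  · rw [hΛ0] at h1 h2; exact ⟨h1, h2⟩
  · omega
  · omega

/-- `e^{iη∂λ}` for a bond field of commuting values is a pure gauge: `e^{iη(λ(x+e_μ) − λ(x))} = u(x)·1·u(x+e_μ)⁻¹`, `u = e^{−iηλ}` ((8) of [3]).
[cite: Balaban1985Averaging, (8) p.18; Balaban1985BackgroundPropagators, (3.28) p.395] -/
theorem cfgExp_grad_eq_gaugeAct_of_commute {𝔸 : Type*} [CStarAlgebra 𝔸] (η : ℝ) (lam : Site d → 𝔸)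
    (hcomm : ∀ u v, Commute (lam u) (lam v)) :
    cfgExp η (fun x μ => lam (x + e μ) - lam x) = gaugeAct (fun x => expUnit (-(I • ((η : ℝ) • lam x)))) 1 := by
  letI : NormedAlgebra ℚ 𝔸 := NormedAlgebra.restrictScalars ℚ ℂ 𝔸
  funext y τ
  apply Units.ext
  simp only [cfgExp, gaugeAct, Pi.one_apply, mul_one, Units.val_mul, B7Prop1Explicit.val_expUnit,
    B7Prop1Explicit.val_inv_expUnit, neg_neg, smul_sub]
  rw [sub_eq_add_neg, add_comm]
  refine exp_add_of_commute ?_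
  exact (((hcomm y (y + e τ)).smul_right η).smul_right I |>.smul_left η |>.smul_left I).neg_left

/-! ## §3 The socket of Proposition 3's frame is FALSE at truncation `1` of every top-cube member -/

section Socket

variable {𝔸 : Type*} [CStarAlgebra 𝔸] [Nontrivial 𝔸]

/-- ★★★ **`SockB9P3 … η 1 Ω Λs Λb` IS FALSE AT EVERY MEMBER WHOSE TRUNCATION-1 TOWER IS PRINT's `(T, □₁)`** — `Ω 0 = ℤᵈ`, `Ω 1 = □₁`,
`Λs 1 0 = ℤᵈ ∖ □₁`, `Λs 1 1 = □₁^{(1)}`, `Λb 1 = towerBonds` (law №12) — for every `B₀, B₀β, β, len` and `cP > 0` (`d ≥ 2`, `L ≥ 1`, `ρ ≥ 1`,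
`k ≥ 1`).  Instance: `α₀ = α₂ = cP`, `U₀ = 1`, `A′ = (t·∂λ)·1_𝔸` (`λ` the real shell mode of `exists_real_shellMode`, `t` small), `W = e^{iηA′}` (unitary
pure gauge ⇒ `W·1 ∈ 𝔄_1`; Landau of record by `isLandau138_univ_of_shellMode` + the «⊗ identity» transfer `B8Ineq159FlatMaps.isLandau138_map_flat`;
`(iη)⁻¹log W = A′`); line 1 reads `η·‖A′(b₀)‖ ≤ |A′|₍₋₁₎ ≤ B₀(|J(A′)|₍₋₃₎ + |B₁(A′)|) = B₀(0 + 0)`: `J = 0` (`Jcur_one_grad`), `|B₁| = 0` (level 0: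
both ends off `□₁`; level 1: both ends in `□₁^{(1)}`, equal block sums) — contradiction at a bond `b₀` where `λ` jumps.
[cite: Balaban1985RegularSpaces, (1.57)–(1.59) p.86, (1.31) p.82, (1.36)–(1.38) p.82, (1.40) p.83, (1.131) p.99; Balaban1985BackgroundPropagators, Thm 3.3 p.398, p.394 («⊗ identity»); Balaban1984PropagatorsII, (2.3) p.224] -/
theorem not_sockB9P3_of_topCube (hd2 : 2 ≤ d) {L : ℕ} (hL : 1 ≤ L) (i : ZdIdx d L) {a : Site d} {M ρ : ℕ} (hρ : 1 ≤ ρ)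
    (hΩ0 : i.Ω 0 = Set.univ) (hΩ1 : i.Ω 1 = cube L a M ρ i.k 1)
    (hΛ0 : i.Λs 1 0 = (cube L a M ρ i.k 1)ᶜ) (hΛ1 : i.Λs 1 1 = {z | InBox (sqLo L a ρ i.k 1) (sqHi L a M ρ i.k 1) z})
    (hΛb : ∀ j, i.Λb 1 j = towerBonds L i.Ω (i.Λs 1) j)
    {B₀ B₀β cP β : ℝ} {len : Site d → ℝ} (hcP : 0 < cP) :
    ¬ SockB9P3 (𝔸 := 𝔸) L B₀ B₀β cP β len i.η 1 i.Ω i.Λs i.Λb := by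
  classical
  intro H
  have hη : 0 < i.η := i.hη
  have hk : 1 ≤ i.k := i.hk
  have hL1 : (1 : ℝ) ≤ L := by exact_mod_cast hL
  have hηne : i.η ≠ 0 := hη.ne'
  -- the size budget and the real shell mode
  obtain ⟨Λ₀, hΛ₀, hmode⟩ := exists_real_shellMode hL i.η a M hρ i.k
  obtain ⟨T, hT_def⟩ : ∃ T : ℝ, T = min (cP * ((L : ℝ) * i.η)⁻¹) (2 * i.η)⁻¹ := ⟨_, rfl⟩
  have hT0 : 0 < T := by rw [hT_def]; exact lt_min (by positivity) (by positivity)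
  have hT1 : T ≤ cP * ((L : ℝ) * i.η)⁻¹ := by rw [hT_def]; exact min_le_left _ _
  have hT2 : T ≤ (2 * i.η)⁻¹ := by rw [hT_def]; exact min_le_right _ _
  set t : ℝ := T * i.η / (Λ₀ + Λ₀ + 1) with ht_def
  have hden : 0 < Λ₀ + Λ₀ + 1 := by positivity
  have ht0 : 0 < t := by rw [ht_def]; positivity
  obtain ⟨lam, hreal, hsupp, ⟨x₀, hx₀⟩, hbdd, hsum, hlan⟩ := hmode t ht0.ne'
  have habs : |t| = t := abs_of_pos ht0
  have hlamb : ∀ x, ‖lam x‖ ≤ t * Λ₀ := fun x => by rw [← habs]; exact hbdd x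
  -- the `ℂ`-valued gradient and its `𝔸`-valued copy `A′ = φ • 1`
  set φ : Site d → Fin d → ℂ := fun y τ => covDerivFwd i.η (1 : Site d → Fin d → ℂˣ) τ lam y with hφdef
  have hφ : ∀ y τ, φ y τ = i.η⁻¹ • (lam (y + e τ) - lam y) := fun y τ => covDerivFwd_flat_apply i.η τ lam y
  have hφbd : ∀ y τ, ‖φ y τ‖ ≤ i.η⁻¹ * (t * Λ₀ + t * Λ₀) := fun y τ =>
    B8Ineq159FlatMaps.norm_covDerivFwd_flat_le hη hlamb τ y
  have hφT : ∀ y τ, ‖φ y τ‖ ≤ T := by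
    intro y τ
    refine (hφbd y τ).trans ?_
    rw [ht_def]
    rw [show i.η⁻¹ * (T * i.η / (Λ₀ + Λ₀ + 1) * Λ₀ + T * i.η / (Λ₀ + Λ₀ + 1) * Λ₀) = T * ((Λ₀ + Λ₀) / (Λ₀ + Λ₀ + 1)) by
      field_simp]
    calc T * ((Λ₀ + Λ₀) / (Λ₀ + Λ₀ + 1)) ≤ T * 1 :=
          mul_le_mul_of_nonneg_left ((div_le_one hden).2 (by linarith)) hT0.le
      _ = T := mul_one T
  let ι : ℂ →L[ℂ] 𝔸 := (ContinuousLinearMap.id ℂ ℂ).smulRight (1 : 𝔸)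
  have hι : ∀ z : ℂ, ι z = z • (1 : 𝔸) := fun z => rfl
  set lamA : Site d → 𝔸 := fun x => ι (i.η⁻¹ • lam x) with hlamA
  set A' : Site d → Fin d → 𝔸 := fun y τ => ι (φ y τ) with hA'
  have hA'g : A' = fun y τ => lamA (y + e τ) - lamA y := by
    funext y τ
    simp only [hA', hlamA, hφ, smul_sub, map_sub]
  have hA'norm : ∀ y τ, ‖A' y τ‖ = ‖φ y τ‖ := fun y τ => by
    show ‖ι (φ y τ)‖ = ‖φ y τ‖
    rw [hι, norm_smul, norm_one, mul_one]
  have hA'sa : ∀ y τ, IsSelfAdjoint (A' y τ) := by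
    intro y τ
    have : φ y τ = (((φ y τ).re : ℝ) : ℂ) := by
      rw [hφ, ← hreal (y + e τ), ← hreal y]
      simp [Complex.ofReal_re, Complex.sub_re]
    show IsSelfAdjoint (ι (φ y τ))
    rw [hι, this]
    exact isSelfAdjoint_real_smul_one _
  have hlamA_sa : ∀ x, IsSelfAdjoint ((i.η : ℝ) • lamA x) := by
    intro x
    show IsSelfAdjoint ((i.η : ℝ) • ι (i.η⁻¹ • lam x))
    rw [hι, ← hreal x]
    rw [show i.η⁻¹ • (((lam x).re : ℝ) : ℂ) = (((i.η⁻¹ * (lam x).re : ℝ)) : ℂ) by push_cast; rw [Complex.real_smul]; push_cast; ring]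
    exact IsSelfAdjoint.smul (IsSelfAdjoint.all i.η) (isSelfAdjoint_real_smul_one _)
  have hcomm : ∀ u v, Commute (lamA u) (lamA v) := fun u v => by
    show Commute (ι (i.η⁻¹ • lam u)) (ι (i.η⁻¹ • lam v))
    rw [hι, hι]
    exact (Commute.one_right _).smul_right _
  -- the pure gauge `W = e^{iηA′}`
  set W : Site d → Fin d → 𝔸ˣ := cfgExp i.η A' with hW
  have h1u : ∀ x κ, (1 : Site d → Fin d → 𝔸ˣ) x κ ∈ unitaryUnits 𝔸 := fun _ _ => (unitaryUnits 𝔸).one_mem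
  have hWu : ∀ x κ, W x κ ∈ unitaryUnits 𝔸 := fun x κ => cfgExp_mem_unitaryUnits i.η hA'sa x κ
  have hA1 : InAk L 1 i.η cP i.Ω (1 : Site d → Fin d → 𝔸ˣ) := B8Prop6OfThm4.one_inAk hL 1 hη hcP i.Ω
  have hAW : InAk L 1 i.η cP i.Ω (mulCfg W 1) := by
    rw [B8Thm4Concrete.mulCfg_eq_mul, mul_one, hW, hA'g, cfgExp_grad_eq_gaugeAct_of_commute i.η lamA hcomm]
    exact (B8Ineq132.inAk_gaugeAct_iff L 1 i.η cP i.Ω (fun x => unitaryUnits_le_U1 (expUnit_skew_mem_unitaryUnits (hlamA_sa x))) 1).2 hA1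
  -- the Landau condition of record for `A′`: the `ℂ`-level one transported by `ι`
  have hLanC : IsLandau138 L 1 i.η (i.Ω 0) (i.Λs 1) (1 : Site d → Fin d → ℂˣ) φ := by
    rw [hΩ0]
    exact isLandau138_univ_of_shellMode hL i.η hρ hk hsupp hlan hΛ0 hΛ1
  have hLanA : IsLandau138 L 1 i.η (i.Ω 0) (i.Λs 1) (1 : Site d → Fin d → 𝔸ˣ) A' :=
    B8Ineq159FlatMaps.isLandau138_map_flat ι hLanC
  have hLan : IsLandau138W L 1 i.η (i.Ω 0) (i.Λs 1) 1 W := by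
    unfold IsLandau138W
    have hsmall : ∀ (y : Site d) (τ : Fin d), i.η * ‖A' y τ‖ < Real.log 2 := fun y τ =>
      calc i.η * ‖A' y τ‖ ≤ i.η * (2 * i.η)⁻¹ := by
            rw [hA'norm]; exact mul_le_mul_of_nonneg_left ((hφT y τ).trans hT2) hη.le
        _ = 1 / 2 := by field_simp
        _ < Real.log 2 := by have h := Real.log_two_gt_d9; norm_num at h ⊢; linarith
    rw [hW, logCfg_cfgExp_of_small hη hsmall]
    exact hLanA
  have hsides : ∀ j, j ≤ 1 → ∀ (y : Site d) (τ : Fin d), SideTouches (i.Ω j) y τ →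
      W y τ = cfgExp i.η A' y τ ∧ ‖A' y τ‖ ≤ cP * ((L : ℝ) ^ j * i.η)⁻¹ := by
    intro j hj y τ _
    refine ⟨rfl, ?_⟩
    rw [hA'norm]
    refine (hφT y τ).trans (hT1.trans (mul_le_mul_of_nonneg_left ?_ hcP.le))
    refine inv_anti₀ (by positivity) (mul_le_mul_of_nonneg_right ?_ hη.le)
    calc (L : ℝ) ^ j ≤ (L : ℝ) ^ 1 := pow_le_pow_right₀ hL1 hj
      _ = L := pow_one _
  have hφ0 : ∀ y τ, y ∉ cube L a M ρ i.k 1 → y + e τ ∉ cube L a M ρ i.k 1 → φ y τ = 0 := fun y τ hy hy' =>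
    grad_eq_zero_of_notMem hsupp hy hy'
  have hoff : ∀ (y : Site d) (τ : Fin d), (∀ j, j ≤ 1 → ¬ SideTouches (i.Ω j) y τ) → A' y τ = 0 := by
    intro y τ h
    obtain ⟨κ', hκ'⟩ := exists_ne_fin hd2 τ
    exact absurd (sideTouches_of_bondTouches hκ' (Or.inl (by rw [hΩ0]; exact Set.mem_univ y))) (h 0 (Nat.zero_le 1))
  obtain ⟨h1, -, -, -, -⟩ := H cP cP hcP le_rfl hcP le_rfl 1 W h1u hWu hA1 hAW hLan A' hA'sa hsides hoff
  -- the right-hand side of line 1 vanishes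
  have hJ : bondNorm L 1 i.η (-(3 : ℝ)) i.Ω (fun x μ => Jcur i.η (1 : Site d → Fin d → 𝔸ˣ) A' μ x) = 0 := by
    have : (fun x μ => Jcur i.η (1 : Site d → Fin d → 𝔸ˣ) A' μ x) = 0 := by
      funext x μ; rw [hA'g]; exact Jcur_one_grad i.η lamA μ x
    rw [this, bondNorm_zero]
  have hdata : ∀ p : {p : ℕ × (Site d × Fin d) // p.1 ≤ 1 ∧ p.2 ∈ i.Λb 1 p.1},
      linCovIter L (1 : Site d → Fin d → 𝔸ˣ) (iEta i.η A') p.1.1 p.1.2.1 p.1.2.2 = 0 := by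
    rintro ⟨⟨j, y, τ⟩, hj, hmem⟩
    simp only at hj hmem ⊢
    rw [hΛb] at hmem
    -- `ι` commutes with the flat composite averages (⊗ identity)
    have hTb : 0 ≤ i.η * T := by positivity
    have hιA : ∀ w ν, ι (iEta i.η φ w ν) = iEta i.η A' w ν := fun w ν => by
      simp only [B8Eq146AExpansion.iEta_def, hA', map_smul]
    have hmap := B8Ineq159FlatMaps.map_linCovIter_flat ι hL (iEta i.η φ) hTb
      (fun w ν => B8Eq146AExpansion.norm_iEta_le hη.le hφT w ν) j y τ
    simp only [hιA] at hmap
    rw [← hmap]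
    rcases Nat.le_one_iff_eq_zero_or_eq_one.mp hj with rfl | rfl
    · -- level 0: both ends off `□₁`
      obtain ⟨hy, hy'⟩ := towerBonds_zero_ends hΛ0 hmem
      rw [linCovIter_zero]
      simp [B8Eq146AExpansion.iEta_def, hφ0 y τ hy hy']
    · -- level 1: both ends in `□₁^{(1)}`, equal block sums
      obtain ⟨hz, hz'⟩ := towerBonds_one_ends hL hΩ1 hmem
      rw [linCovIter_one_grad_level_one hL hη hlamb y τ, hsum (y + e τ) y hz' hz, sub_self, mul_zero, smul_zero, map_zero]
  have hB1 : wsup 1 (fun p : {p : ℕ × (Site d × Fin d) // p.1 ≤ 1 ∧ p.2 ∈ i.Λb 1 p.1} =>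
      linCovIter L (1 : Site d → Fin d → 𝔸ˣ) (iEta i.η A') p.1.1 p.1.2.1 p.1.2.2) = 0 :=
    le_antisymm (wsup_le (fun p => by rw [hdata p, norm_zero, mul_zero]) le_rfl) (wsup_nonneg zero_le_one _)
  rw [hJ, hB1] at h1
  simp only [add_zero, mul_zero] at h1
  -- the left-hand side of line 1 is positive at a bond where `λ` jumps
  set τ₀ : Fin d := ⟨0, by omega⟩ with hτ₀
  have hP' : ∃ s : ℕ, lam (x₀ + ((s + 1 : ℕ) : ℤ) • e τ₀) = 0 := by
    by_contra hall
    push Not at hall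
    have hmem : ∀ s : ℕ, x₀ + ((s + 1 : ℕ) : ℤ) • e τ₀ ∈ cube L a M ρ i.k 1 := fun s => by
      by_contra h; exact hall s (hsupp _ h)
    have hinj : Function.Injective (fun s : ℕ => x₀ + ((s + 1 : ℕ) : ℤ) • e τ₀) := by
      intro s s' h
      have := congrFun h τ₀
      simp only [Pi.add_apply, Pi.smul_apply, smul_eq_mul, e, Pi.single_eq_same, mul_one, add_right_inj] at this
      omega
    have hfin : (cube L a M ρ i.k 1).Finite := inBox_finite _ _
    exact (Set.infinite_range_of_injective hinj) (hfin.subset (by rintro _ ⟨s, rfl⟩; exact hmem s))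
  obtain ⟨s₀, hs₀, hmin⟩ : ∃ s₀ : ℕ, lam (x₀ + ((s₀ + 1 : ℕ) : ℤ) • e τ₀) = 0 ∧ lam (x₀ + (s₀ : ℤ) • e τ₀) ≠ 0 := by
    refine ⟨Nat.find hP', Nat.find_spec hP', ?_⟩
    rcases Nat.eq_zero_or_pos (Nat.find hP') with h0 | hpos
    · rw [h0]; simpa using hx₀
    · have := Nat.find_min hP' (m := Nat.find hP' - 1) (by omega)
      rwa [show Nat.find hP' - 1 + 1 = Nat.find hP' by omega] at this
  set y₀ : Site d := x₀ + (s₀ : ℤ) • e τ₀ with hy₀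
  have hy₀e : y₀ + e τ₀ = x₀ + ((s₀ + 1 : ℕ) : ℤ) • e τ₀ := by
    rw [hy₀]; push_cast; rw [add_smul, one_smul, add_assoc]
  have hφy₀ : φ y₀ τ₀ ≠ 0 := by
    rw [hφ, hy₀e, hs₀, zero_sub]
    exact smul_ne_zero (inv_ne_zero hηne) (neg_ne_zero.2 hmin)
  obtain ⟨κ, hκ⟩ := exists_ne_fin hd2 τ₀
  have hside : SideTouches (i.Ω 0) y₀ τ₀ := sideTouches_of_bondTouches hκ (Or.inl (by rw [hΩ0]; exact Set.mem_univ _))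
  have hBdd : Bdd L 1 i.η (-(1 : ℝ)) (fun j (b : Site d × Fin d) => SideTouches (i.Ω j) b.1 b.2) (fun b => A' b.1 b.2) := by
    refine ⟨((L : ℝ) * i.η) * T, fun j hj b _ => ?_⟩
    have hw : weight L i.η (-(1 : ℝ)) j = (L : ℝ) ^ j * i.η := by simp only [weight, neg_neg, Real.rpow_one]
    have hwle : weight L i.η (-(1 : ℝ)) j ≤ (L : ℝ) * i.η := by
      rw [hw]
      have : (L : ℝ) ^ j ≤ (L : ℝ) ^ 1 := pow_le_pow_right₀ hL1 hj
      rw [pow_one] at this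
      exact mul_le_mul_of_nonneg_right this hη.le
    rw [hA'norm]
    exact mul_le_mul hwle (hφT b.1 b.2) (norm_nonneg _) (by positivity)
  have hle := weight_mul_norm_le_msup hBdd (j := 0) (Nat.zero_le 1) (i := (y₀, τ₀)) hside
  have hw0 : weight L i.η (-(1 : ℝ)) 0 = i.η := by simp [weight]
  dsimp only at hle
  rw [hw0, hA'norm] at hle
  have hpos : 0 < i.η * ‖φ y₀ τ₀‖ := mul_pos hη (norm_pos_iff.2 hφy₀)
  linarith

end Socket


/-! ## §4 A LAWFUL top-cube member: `Ω₀ = ℤᵈ`, `Ω_j = □_j`, `Λ′₀ = ℤᵈ ∖ □₁`, bond classes generated by the tower (law №12) -/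

section Member

open Node00

/-- ★★ **PRINT'S FAMILY `(T, □₁, …, □_k)` OF (1.131) AS A LAWFUL MEMBER OF THE INDEX OF RECORD**: `Ω = cubeFam true …` (`Ω₀ = ℤᵈ`, `Ω_j = □_j`),
restriction sets `Λ′₀ = ℤᵈ ∖ □₁` at every truncation `m ≥ 1` (`ℤᵈ` at `m = 0`) and `cubeLamS … m j` for `j ≥ 1`, bond classes `towerBonds` (so №12
holds by `rfl`); the `ZdIdx` laws `hbox`∕`hclass`∕`htower`∕`hpart` and the located laws `IdxB8Laws` (№7 under `Lᵏη ≤ 1`, №8, №11) all hold.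
[cite: Balaban1985RegularSpaces, (1.131) p.99 («Λ′₀ = T ∖ □₁»), (1.5)–(1.6) p.77, (1.68) p.88, (1.31) p.82, p.86 («𝔅_k»)] -/
theorem exists_topCube_member_lawsB {L : ℕ} (hL : 1 ≤ L) (a : Site d) (M : ℕ) {ρ : ℕ} (hρ : L ≤ ρ) {k : ℕ} (hk : 1 ≤ k)
    {η : ℝ} (hη : 0 < η) (hscale : (L : ℝ) ^ k * η ≤ 1) :
    ∃ i : ZdIdx d L, i.k = k ∧ i.η = η ∧ i.Ω = cubeFam true L a M ρ k ∧ i.Λs 1 0 = (cube L a M ρ k 1)ᶜ ∧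
      i.Λs 1 1 = {z | InBox (sqLo L a ρ k 1) (sqHi L a M ρ k 1) z} ∧ (∀ m j, i.Λb m j = towerBonds L i.Ω (i.Λs m) j) ∧
      IdxB8LawsB L i := by
  classical
  haveI : NeZero L := ⟨by omega⟩
  have hρ1 : 1 ≤ ρ := hL.trans hρ
  -- the truncated tower with print's `Λ′₀`
  let ΛT : ℕ → ℕ → Set (Site d) := fun m j =>
    if j = 0 then (if m = 0 then Set.univ else (cube L a M ρ k 1)ᶜ) else cubeLamS L a M ρ k m j
  have hT0 : ∀ m, 1 ≤ m → ΛT m 0 = (cube L a M ρ k 1)ᶜ := fun m hm => by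
    simp only [ΛT, if_pos rfl, if_neg (show m ≠ 0 by omega)]
  have hT00 : ΛT 0 0 = Set.univ := by simp [ΛT]
  have hTpos : ∀ m j, 1 ≤ j → ΛT m j = cubeLamS L a M ρ k m j := fun m j hj => by
    simp only [ΛT, if_neg (show j ≠ 0 by omega)]
  have h10 : cube L a M ρ k 1 ⊆ cube L a M ρ k 0 := cube_succ_subset (by omega)
  have hΩpos : ∀ j, 1 ≤ j → j ≤ k → cubeFam true L a M ρ k j = cubeFam false L a M ρ k j := fun j hj hjk => by
    rw [cubeFam_of_pos true L a M ρ hj hjk, cubeFam_of_pos false L a M ρ hj hjk]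
  -- a level-0 restriction site of the `false` member lies outside `□₁`
  have hlam0 : ∀ y ∈ cubeLamS L a M ρ k k 0, y ∈ (cube L a M ρ k 1)ᶜ := fun y hy => by
    rw [cubeLamS_of_lt L a M ρ k (by omega : 0 < k)] at hy
    exact ((mem_cubeLam_zero_iff hL a M ρ hk y).1 hy).2
  have hself0 : ∀ x : Site d, InBox (B8Ineq130.tlo L x 0) (B8Ineq130.thi L x 0) x := fun x i => by
    simp [B8Ineq130.tlo_zero, B8Ineq130.thi_zero]
  refine ⟨⟨η, hη, k, hk, cubeFam true L a M ρ k, fun j => (cubeFam_domainSeq true hL a M hρ k).anti j, ΛT,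
    fun m j => towerBonds L (cubeFam true L a M ρ k) (ΛT m) j,
    towerBonds_hbox L _ ΛT k, towerBonds_hclass L _ ΛT k, ?_, ?_⟩, rfl, rfl, rfl, hT0 1 le_rfl, ?_, fun _ _ => rfl, ?_⟩
  · -- htower
    intro j hj y hy x hx
    rcases Nat.eq_zero_or_pos j with rfl | hjpos
    · rw [cubeFam_true_zero]; exact Set.mem_univ x
    · rw [hTpos k j hjpos] at hy
      rw [hΩpos j hjpos hj]
      exact htower_cubeLam hL a M ρ k j hj y hy x hx
  · -- hpart
    intro x _
    by_cases hx0 : x ∈ cube L a M ρ k 0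
    · obtain ⟨j, hjk, y, hy, hB⟩ := hpart_cubeLam hL a M ρ k x (by rw [cubeFam_false_zero]; exact hx0)
      rcases Nat.eq_zero_or_pos j with rfl | hjpos
      · exact ⟨0, hjk, y, by rw [hT0 k hk]; exact hlam0 y hy, hB⟩
      · exact ⟨j, hjk, y, by rw [hTpos k j hjpos]; exact hy, hB⟩
    · exact ⟨0, Nat.zero_le k, x, by rw [hT0 k hk]; exact fun h => hx0 (h10 h), hself0 x⟩
  · -- `Λs 1 1 = □₁^{(1)}`
    show ΛT 1 1 = _
    rw [hTpos 1 1 le_rfl, cubeLamS_self]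
  · -- the located laws
    refine ⟨⟨hscale, ?_, ?_, ?_⟩, fun _ _ => rfl⟩
    · -- №8 below the top
      intro m hm j hj
      show ΛT m j = ΛT (m + 1) j
      rcases Nat.eq_zero_or_pos j with rfl | hjpos
      · rw [hT0 m (by omega), hT0 (m + 1) (by omega)]
      · rw [hTpos m j hjpos, hTpos (m + 1) j hjpos]
        exact B8SockHFPCubeMember.h8lt_cubeLamS L a M ρ k m hm j hj
    · -- №8 at the top
      intro m hm x
      show x ∈ ΛT m m ↔ x ∈ ΛT (m + 1) m ∨ ∃ y ∈ ΛT (m + 1) (m + 1), x ∈ blockSites L y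
      rcases Nat.eq_zero_or_pos m with rfl | hmpos
      · rw [hT00, hT0 1 le_rfl, hTpos 1 1 le_rfl, cubeLamS_self]
        refine ⟨fun _ => ?_, fun _ => Set.mem_univ x⟩
        by_cases hx1 : x ∈ cube L a M ρ k 1
        · obtain ⟨z, hz, hu⟩ := (mem_cube_iff hL).1 hx1
          refine Or.inr ⟨z, hz, ?_⟩
          rw [mem_blockSites_iff]
          have := (under_iff_blockMap_eq hL 1 z x).1 hu
          rwa [pow_one] at this
        · exact Or.inl hx1
      · rw [hTpos m m hmpos, hTpos (m + 1) m hmpos, hTpos (m + 1) (m + 1) (by omega)]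
        exact B8SockHFPCubeMember.h8top_cubeLamS hL a M ρ k m hm x
    · -- №11 (1.6) at every level
      intro ℓ hℓ w hw
      show ∃ j, ℓ ≤ j ∧ j ≤ k ∧ ∃ y ∈ ΛT k j, Under L (j - ℓ) y w
      rcases Nat.eq_zero_or_pos ℓ with rfl | hℓpos
      · by_cases hw0 : w ∈ cube L a M ρ k 0
        · have hw' : ∀ x, InBox (B8Ineq130.tlo L w 0) (B8Ineq130.thi L w 0) x → x ∈ cubeFam false L a M ρ k 0 := by
            intro x hx
            have hxw : x = w := funext fun i => by
              have := hx i; simp [B8Ineq130.tlo_zero, B8Ineq130.thi_zero] at this; omega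
            rw [hxw, cubeFam_false_zero]; exact hw0
          obtain ⟨j, h0j, hjk, y, hy, hU⟩ := B8CubeMemberIdxB8Laws.cover_cubeLamS hL a M ρ k 0 (Nat.zero_le k) w hw'
          rcases Nat.eq_zero_or_pos j with rfl | hjpos
          · exact ⟨0, le_rfl, hjk, y, by rw [hT0 k hk]; exact hlam0 y hy, hU⟩
          · exact ⟨j, h0j, hjk, y, by rw [hTpos k j hjpos]; exact hy, hU⟩
        · refine ⟨0, le_rfl, Nat.zero_le k, w, by rw [hT0 k hk]; exact fun h => hw0 (h10 h), ?_⟩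
          rw [Nat.sub_zero]; exact (B8Eq131Derivation.under_zero_iff L w w).2 rfl
      · have hw' : ∀ x, InBox (B8Ineq130.tlo L w ℓ) (B8Ineq130.thi L w ℓ) x → x ∈ cubeFam false L a M ρ k ℓ := by
          intro x hx; rw [← hΩpos ℓ hℓpos hℓ]; exact hw x hx
        obtain ⟨j, hℓj, hjk, y, hy, hU⟩ := B8CubeMemberIdxB8Laws.cover_cubeLamS hL a M ρ k ℓ hℓ w hw'
        exact ⟨j, hℓj, hjk, y, by rw [hTpos k j (by omega)]; exact hy, hU⟩

variable (θ : Stage3Params)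

/-- ★★★ **THE SUB-INDEX OF RECORD CONTAINS A LAWFUL SHELL MEMBER AT WHICH THE SOCKET OF PROPOSITION 3's FRAME FAILS** (`D ≥ 2`): print's family
`(T, □₁)` (`k = 1`, `η = L⁻¹`, `a = 0`, `M = 1`, `ρ = L`) as a term `i : IdxB8SubB θ`, and `¬ SockB9P3 θ.L B₀ B₀β cP β len i.η 1 i.Ω i.Λs i.Λb` for
EVERY `B₀, B₀β, β, len` and `cP > 0` (`not_sockB9P3_of_topCube`). [cite: Balaban1985RegularSpaces, (1.131) p.99, (1.59) p.86, (1.31) p.82; Balaban1985BackgroundPropagators, Thm 3.3 p.398; Balaban1984PropagatorsII, (2.3) p.224] -/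
theorem exists_idxB8SubB_not_sockB9P3 (hD : 2 ≤ θ.D) :
    ∃ i : IdxB8SubB θ, 1 ≤ i.1.1.k ∧ (∃ (a : Site θ.D) (M ρ : ℕ), i.1.1.Ω 1 = cube θ.L a M ρ i.1.1.k 1) ∧
      ∀ (B₀ B₀β cP β : ℝ) (len : Site θ.D → ℝ), 0 < cP →
        ¬ SockB9P3 (𝔸 := θ.𝔸) θ.L B₀ B₀β cP β len i.1.1.η 1 i.1.1.Ω i.1.1.Λs i.1.1.Λb := by
  have hL : 1 ≤ θ.L := le_trans (by norm_num) θ.two_le_L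
  have hη : (0 : ℝ) < ((θ.L : ℝ)⁻¹) ^ 1 := pow_pos (inv_pos.mpr (by exact_mod_cast (show 0 < θ.L by omega))) 1
  have hscale : (θ.L : ℝ) ^ 1 * ((θ.L : ℝ)⁻¹) ^ 1 ≤ 1 := by
    rw [pow_one, pow_one, mul_inv_cancel₀ (by exact_mod_cast (show θ.L ≠ 0 by omega))]
  obtain ⟨i, hik, hiη, hΩ, hΛ0, hΛ1, hΛb, hlaws⟩ :=
    exists_topCube_member_lawsB (d := θ.D) hL (0 : Site θ.D) 1 (le_refl θ.L) (le_refl 1) hη hscale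
  have hΩ0 : i.Ω 0 = Set.univ := by rw [hΩ]; exact cubeFam_true_zero θ.L 0 1 θ.L 1
  refine ⟨⟨⟨i, hΩ0⟩, hlaws⟩, by simp [hik], ⟨0, 1, θ.L, ?_⟩, fun B₀ B₀β cP β len hcP => ?_⟩
  · show i.Ω 1 = cube θ.L 0 1 θ.L i.k 1
    rw [hΩ, hik]; exact cubeFam_of_pos true θ.L 0 1 θ.L le_rfl le_rfl
  · have hΩ1 : i.Ω 1 = cube θ.L 0 1 θ.L i.k 1 := by
      rw [hΩ, hik]; exact cubeFam_of_pos true θ.L 0 1 θ.L le_rfl le_rfl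
    have hΛ0' : i.Λs 1 0 = (cube θ.L 0 1 θ.L i.k 1)ᶜ := by rw [hik]; exact hΛ0
    have hΛ1' : i.Λs 1 1 = {z | InBox (sqLo θ.L 0 θ.L i.k 1) (sqHi θ.L 0 1 θ.L i.k 1) z} := by rw [hik]; exact hΛ1
    exact not_sockB9P3_of_topCube (𝔸 := θ.𝔸) hD hL i hL hΩ0 hΩ1 hΛ0' hΛ1' (fun j => hΛb 1 j) hcP

/-- ★★★ **THE `SB9all`-OVER-`IdxB8SubB` FAMILY IS UNSATISFIABLE** (`D ≥ 2`, every `B₀, B₀β, β, len`, `cP > 0`): the hypothesis «`∀ i : IdxB8SubB θ,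
∀ m ≤ k, SockB9P3 … m …`» that the `Ω₀ = ℤᵈ` knits take (and that n06-b's `sockB9P3_allLevels_univ_explicit_on` derives from `B9.Thm33Printed` + the
law-member dictionary) is FALSE — instance `m = 1` at the shell member of `exists_idxB8SubB_not_sockB9P3`.
[cite: Balaban1985RegularSpaces, Thm 4 p.88, (1.59) p.86, (1.31) p.82, (1.131) p.99; Balaban1985BackgroundPropagators, Thm 3.3 p.398] -/
theorem not_sB9all_idxB8SubB (hD : 2 ≤ θ.D) (B₀ B₀β cP β : ℝ) (len : Site θ.D → ℝ) (hcP : 0 < cP) :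
    ¬ (∀ i : IdxB8SubB θ, ∀ m, m ≤ i.1.1.k →
        SockB9P3 (𝔸 := θ.𝔸) θ.L B₀ B₀β cP β len i.1.1.η m i.1.1.Ω i.1.1.Λs i.1.1.Λb) := by
  intro h
  obtain ⟨i, hk, -, hnot⟩ := exists_idxB8SubB_not_sockB9P3 θ hD
  exact hnot B₀ B₀β cP β len hcP (h i 1 hk)

#print axioms not_sB9all_idxB8SubB

end Member

end Literature.MathematicalPhysics.QuantumFieldTheory.Balaban1983to89.B8SockB9P3ShellModeVacuityUniv

end
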